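import Summits.HubbardSuperconductivity.HubbardSuperconductivity.Theorems.KkFloorKkFloorTheorem
import Summits.HubbardSuperconductivity.HubbardSuperconductivity.Theorems.KkBandLift.Negative.PoissonFixedHeight

/-!
# `KkBandLift` (crux stmt-HubbardSuperconductivity-10402, route `KkFloor`) — negative side, N1:
# the Kramers–Kronig floor at FINITE HEIGHT `x > 0` (potential theory, no physics)

Refuter file (B2b-4, HONEST FRAMING: the value here is a THEOREM — a kernel-checked ingredient of
`¬ KkBandLift` — not summit progress).

`finiteXFloor` is the proposition `FiniteXFloor` of the strategist's negation skeleton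
`Cruxes/KkBandLift/StrategistNegation.lean` (N1), proved: for Hermitian `A`, Hermitian `B` with
nonnegative form, a subspace `V` invariant under both, a real `E` below the Rayleigh quotient of
`A` on unit vectors of `V`, a height `x > 0`, a set `S ⊆ ℝ` and ANY profile `d` with
`E + d(y) ≤ Re λ` for every eigenpair `(λ, v)`, `v ∈ V ∖ 0`, of `A + iyB` with `y ∈ S`:
for every unit `φ ∈ V`,
`∫⁻_S d(y)·x/(x²+y²) dy ≤ π ((Re⟨φ,Aφ⟩ - E) + x·Re⟨φ,Bφ⟩)`.
With the band lift (`d ≡ εL²` on `S = [Y₁,Y₂]`) at `x = 1` this says that `KkBandLift` forces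
`d`-wave pair order on EVERY sector state of energy density `< ε(Y₂-Y₁)/(2π(1+Y₂²))`, which the
thermal shell (Koma–Tasaki) forbids — see the companion files of this directory.

EXTRACTION, with named sources:
* `PoissonFixedHeight.lintegral_poisson_le_of_subharmonic` — `stepA` of
  `Literature.Analysis.Potential.lintegral_boundary_le_of_subharmonic` at one point `x`.
* `finiteXFloor_core` — the case `V = ℂⁿ`: the coordinate-free part of
  `Summit.…Theorems.kkFloor_core` (`u = log ρ(e^{-(A+zB)}) + E`, Vesentini subharmonicity
  `Literature.Analysis.Matrix.isSubharmonicOn_log_spectralRadius_exp_pencil`, numerical range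
  `u ≤ 0` on `Re z ≥ 0`, eigenvalue comparison `log_spectralRadius_exp_le` /
  `neg_re_le_log_spectralRadius_exp`), with Rayleigh–Ritz at the unit vector `φ`
  (`Matrix.groundEnergy_le_rayleigh_holds`) replacing the ground-state eigen-equation — no ground
  state and no `V ≠ ⊥` are needed.
* `finiteXFloor` — the `stdOrthonormalBasis` reduction of `Summit.…Theorems.kkFloorTheorem_proof`,
  verbatim, with `φ` in place of `ψ`.

Sources: T. Ransford, *Potential Theory in the Complex Plane* (1995) §2.4, Thm 6.4.2
[Ransford1995]; T. Kato (1966) II-§2.3. Folklore; no definition is introduced.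
-/

set_option linter.dupNamespace false

noncomputable section

namespace Summit.HubbardSuperconductivity.HubbardSuperconductivity.Theorems.KkBandLift.Negative

open Matrix Complex MeasureTheory Set Filter Metric
open scoped Real Topology ENNReal ComplexOrder InnerProductSpace
open Literature.Analysis.Matrix Literature.Analysis.Pluripotential Literature.Analysis.Potential
open Literature.MathematicalPhysics.QuantumLattice
open Summit.HubbardSuperconductivity.HubbardSuperconductivity.Theorems
  (exists_unit_eigenvector_of_mem_spectrum re_eigenvalue_eq setLIntegral_le_lintegral_of_forall_mem
    isHermitian_of_forall_star_dotProduct_mulVec star_dotProduct_mulVec_comm_of_isHermitian)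

/-! ### The finite-height floor, core matrix form (`V = ℂⁿ`) -/

/-- **The Kramers–Kronig floor at finite height, core matrix form** (`V = ℂⁿ`): for Hermitian
`A`, Hermitian `B` with nonnegative form, `E` below every unit Rayleigh quotient of `A`, a height
`x > 0`, any `S ⊆ ℝ` and any profile `d` with `E + d(y) ≤ Re λ` for all eigenpairs of `A + iyB`,
`y ∈ S`, and every unit vector `φ`:
`∫⁻_S d(y)·x/(x²+y²) ≤ π ((Re⟨φ,Aφ⟩ - E) + x·Re⟨φ,Bφ⟩)`.
(`u = log ρ(e^{-(A+zB)}) + E` is subharmonic under the Cayley reparametrisation — Vesentini,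
`isSubharmonicOn_log_spectralRadius_exp_pencil` —, `≤ 0` on `Re z ≥ 0` by the numerical range,
`u(x) ≥ -((Re⟨φ,Aφ⟩ - E) + x Re⟨φ,Bφ⟩)` by Rayleigh–Ritz for the Hermitian `A + xB`
(`Matrix.groundEnergy_le_rayleigh_holds`, `neg_re_le_log_spectralRadius_exp`), and
`d ≤ -u(i·)` on `S` (`log_spectralRadius_exp_le`); then `lintegral_poisson_le_of_subharmonic`.)
The coordinate-free part of `Summit.…Theorems.kkFloor_core` at finite `x`. [cite: Ransford1995, Thm 6.4.2] -/
theorem finiteXFloor_core {n : Type*} [Fintype n] [DecidableEq n] [Nonempty n]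
    (A B : Matrix n n ℂ) (hA : A.IsHermitian) (hB : B.IsHermitian)
    (hBpos : ∀ v : n → ℂ, 0 ≤ (star v ⬝ᵥ B *ᵥ v).re) (E x : ℝ) (hx0 : 0 < x) (S : Set ℝ)
    (d : ℝ → ℝ) (φ : n → ℂ) (hE : ∀ v : n → ℂ, star v ⬝ᵥ v = 1 → E ≤ (star v ⬝ᵥ A *ᵥ v).re)
    (hφ1 : star φ ⬝ᵥ φ = 1)
    (hd : ∀ y ∈ S, ∀ v : n → ℂ, v ≠ 0 → ∀ lam : ℂ,
      (A + (Complex.I * (y : ℂ)) • B) *ᵥ v = lam • v → E + d y ≤ lam.re) :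
    ∫⁻ y in S, ENNReal.ofReal (d y * (x / (x ^ 2 + y ^ 2))) ≤
      ENNReal.ofReal (π * (((star φ ⬝ᵥ A *ᵥ φ).re - E) + x * (star φ ⬝ᵥ B *ᵥ φ).re)) := by
  -- the subharmonic function `u = log ρ(exp(-(A + zB))) + E`
  set U : ℂ → EReal := fun z => ENNReal.log (spectralRadius ℂ (NormedSpace.exp (-(A + z • B))))
    with hU_def
  set u : ℂ → EReal := fun z => U z + ((E : ℝ) : EReal) with hu_def
  set α : ℝ := (star φ ⬝ᵥ A *ᵥ φ).re with hα_def
  set β : ℝ := (star φ ⬝ᵥ B *ᵥ φ).re with hβ_def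
  set γ : ℝ := (α - E) + x * β with hγ_def
  -- eigenvalues of `A + wB` have real part `≥ E` for `Re w ≥ 0`
  have hspecE : ∀ w : ℂ, 0 ≤ w.re → ∀ lam ∈ spectrum ℂ (A + w • B), E ≤ lam.re := by
    intro w hw lam hlam
    obtain ⟨v, hv1, hv⟩ := exists_unit_eigenvector_of_mem_spectrum _ hlam
    rw [re_eigenvalue_eq A B hB w lam v hv1 hv]
    nlinarith [hE v hv1, hBpos v, mul_nonneg hw (hBpos v)]
  -- on `S` they have real part `≥ E + d`
  have hspecS : ∀ y ∈ S, ∀ lam ∈ spectrum ℂ (A + (Complex.I * (y : ℂ)) • B),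
      E + d y ≤ lam.re := by
    intro y hy lam hlam
    obtain ⟨v, hv1, hv⟩ := exists_unit_eigenvector_of_mem_spectrum _ hlam
    have hv0 : v ≠ 0 := by
      intro h0; rw [h0, dotProduct_zero] at hv1; exact zero_ne_one hv1
    exact hd y hy v hv0 lam hv
  -- (u0) `u ≤ 0` on the closed right half-plane
  have hu0 : ∀ z : ℂ, 0 ≤ z.re → u z ≤ 0 := by
    intro z hz
    have h := log_spectralRadius_exp_le A B z E (hspecE z hz)
    simp only [hu_def]
    calc U z + ((E : ℝ) : EReal) ≤ ((-E : ℝ) : EReal) + ((E : ℝ) : EReal) := add_le_add h le_rfl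
      _ = 0 := by rw [← EReal.coe_add]; simp
  -- (ux) `u(x) ≥ -γ` (Rayleigh–Ritz at `φ` for the Hermitian `A + xB`)
  have hux : ((-γ : ℝ) : EReal) ≤ u x := by
    set T : Matrix n n ℂ := A + (x : ℂ) • B with hT
    have hTh : T.IsHermitian := by
      refine hA.add ?_
      unfold Matrix.IsHermitian
      rw [conjTranspose_smul, hB.eq, Complex.star_def, Complex.conj_ofReal]
    obtain ⟨v, hvmem, hv0⟩ := (Submodule.ne_bot_iff _).1 (Matrix.groundSpace_ne_bot_holds hTh)
    rw [Matrix.mem_groundSpace_iff] at hvmem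
    have hE0spec : ((T.groundEnergy : ℝ) : ℂ) ∈ spectrum ℂ (A + (x : ℂ) • B) := by
      rw [← AlgEquiv.spectrum_eq (Matrix.toLinAlgEquiv' : Matrix n n ℂ ≃ₐ[ℂ] _),
        ← Module.End.hasEigenvalue_iff_mem_spectrum]
      refine Module.End.hasEigenvalue_of_hasEigenvector (x := v) ⟨?_, hv0⟩
      rw [Module.End.mem_eigenspace_iff]
      show Matrix.toLin' T v = _
      rw [Matrix.toLin'_apply, hvmem]
    have hray := Matrix.groundEnergy_le_rayleigh_holds hTh φ hφ1
    have hrayval : (star φ ⬝ᵥ T *ᵥ φ).re = α + x * β := by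
      simp only [hT, add_mulVec, dotProduct_add, smul_mulVec, dotProduct_smul, smul_eq_mul,
        Complex.add_re, Complex.mul_re, Complex.ofReal_re, Complex.ofReal_im, zero_mul, sub_zero,
        hα_def, hβ_def]
    have hlow := neg_re_le_log_spectralRadius_exp A B (x : ℂ) hE0spec
    simp only [Complex.ofReal_re] at hlow
    simp only [hu_def]
    calc ((-γ : ℝ) : EReal) = ((-(α + x * β) : ℝ) : EReal) + ((E : ℝ) : EReal) := by
          rw [← EReal.coe_add]; congr 1; rw [hγ_def]; ring
      _ ≤ ((-T.groundEnergy : ℝ) : EReal) + ((E : ℝ) : EReal) := by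
          refine add_le_add (EReal.coe_le_coe_iff.mpr ?_) le_rfl
          linarith
      _ ≤ U x + ((E : ℝ) : EReal) := add_le_add hlow le_rfl
  -- (usub) subharmonicity of the Cayley pull-back at `x`
  have husub : IsSubharmonicOn (fun ζ => u ((x : ℂ) * ((1 + ζ) / (1 - ζ)))) {ζ | ζ ≠ 1} := by
    have hg : DifferentiableOn ℂ (fun ζ : ℂ => (x : ℂ) * ((1 + ζ) / (1 - ζ))) {ζ | ζ ≠ 1} := by
      intro ζ hζ
      refine (DifferentiableAt.const_mul ?_ _).differentiableWithinAt
      refine ((differentiableAt_const _).add differentiableAt_id).div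
        ((differentiableAt_const _).sub differentiableAt_id) ?_
      exact sub_ne_zero.mpr (Ne.symm hζ)
    have h1 := isSubharmonicOn_log_spectralRadius_exp_pencil A B isOpen_ne hg
    exact h1.add (isSubharmonicOn_const E {ζ : ℂ | ζ ≠ 1})
  -- (umeas) measurability of the boundary trace
  have humeas : Measurable fun y : ℝ => u (Complex.I * y) := by
    have h1 := isSubharmonicOn_log_spectralRadius_exp_pencil A B isOpen_univ
      (differentiable_id.differentiableOn : DifferentiableOn ℂ (fun z : ℂ => z) univ)
    have husc : UpperSemicontinuous U := by
      rw [← upperSemicontinuousOn_univ_iff]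
      exact h1.1
    have husc' : UpperSemicontinuous fun y : ℝ => U (Complex.I * y) :=
      husc.comp (continuous_const.mul Complex.continuous_ofReal)
    have hm : Measurable fun y : ℝ => U (Complex.I * y) := husc'.measurable
    exact hm.add measurable_const
  -- the Poisson bound at height `x`
  have hmain := lintegral_poisson_le_of_subharmonic u x γ hx0 hu0 hux husub
  -- `d · k ≤ (-u(i·)) · k` on `S`, `k = x/(x²+y²)`
  have hdom : ∀ y ∈ S, ENNReal.ofReal (d y * (x / (x ^ 2 + y ^ 2))) ≤
      (-u (Complex.I * ((y : ℝ) : ℂ))).toENNReal * ENNReal.ofReal (x / (x ^ 2 + y ^ 2)) := by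
    intro y hy
    have hUS := log_spectralRadius_exp_le A B (Complex.I * (y : ℂ)) (E + d y) (hspecS y hy)
    have hneg : ((d y : ℝ) : EReal) ≤ -u (Complex.I * y) := by
      simp only [hu_def]
      have : U (Complex.I * (y : ℂ)) + ((E : ℝ) : EReal) ≤
          ((-(E + d y) : ℝ) : EReal) + ((E : ℝ) : EReal) :=
        add_le_add hUS le_rfl
      rw [← EReal.coe_add, show -(E + d y) + E = -d y by ring, EReal.coe_neg] at this
      simpa using EReal.neg_le_neg_iff.mpr this
    have hto : ENNReal.ofReal (d y) ≤ (-u (Complex.I * y)).toENNReal :=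
      (EReal.real_coe_toENNReal (d y)).symm.le.trans (EReal.toENNReal_le_toENNReal hneg)
    have hk : 0 ≤ x / (x ^ 2 + y ^ 2) := by positivity
    rcases le_or_gt (d y) 0 with hdy | hdy
    · rw [ENNReal.ofReal_of_nonpos (mul_nonpos_of_nonpos_of_nonneg hdy hk)]
      exact bot_le
    · rw [ENNReal.ofReal_mul hdy.le]
      exact mul_le_mul' hto le_rfl
  have hmeasG : Measurable fun y : ℝ =>
      (-u (Complex.I * ((y : ℝ) : ℂ))).toENNReal * ENNReal.ofReal (x / (x ^ 2 + y ^ 2)) := by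
    refine humeas.neg.ereal_toENNReal.mul (ENNReal.measurable_ofReal.comp ?_)
    exact (measurable_const (a := x)).div ((measurable_const (a := x ^ 2)).add
      (measurable_id.pow_const 2))
  calc ∫⁻ y in S, ENNReal.ofReal (d y * (x / (x ^ 2 + y ^ 2)))
      ≤ ∫⁻ y : ℝ, (-u (Complex.I * ((y : ℝ) : ℂ))).toENNReal * ENNReal.ofReal (x / (x ^ 2 + y ^ 2)) :=
        setLIntegral_le_lintegral_of_forall_mem S hmeasG hdom
    _ ≤ ENNReal.ofReal (π * γ) := hmain

/-! ### The finite-height floor in an invariant subspace (statement `FiniteXFloor`, N1) -/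

/-- **N1 `FiniteXFloor`** (the Kramers–Kronig floor at finite height, in an invariant subspace).
For Hermitian `A`, Hermitian `B` with nonnegative form, a subspace `V` invariant under both, a real
`E` below the Rayleigh quotient of `A` on unit vectors of `V`, a height `x > 0`, a set `S ⊆ ℝ` and
ANY profile `d` with `E + d(y) ≤ Re λ` for every eigenpair `(λ, v)`, `v ∈ V ∖ 0`, of `A + iyB`,
`y ∈ S`: for every unit `φ ∈ V`, `∫⁻_S d(y)·x/(x²+y²) dy ≤ π ((Re⟨φ,Aφ⟩ - E) + x·Re⟨φ,Bφ⟩)`.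
Isometric coordinates on `V` (`stdOrthonormalBasis`, exactly as in
`Summit.…Theorems.kkFloorTheorem_proof`), then `finiteXFloor_core`. This is literally the
proposition `FiniteXFloor` of `Cruxes/KkBandLift/StrategistNegation.lean`. [cite: Ransford1995, Thm 6.4.2] -/
theorem finiteXFloor :
    ∀ (n : Type) [Fintype n] [DecidableEq n] (A B : Matrix n n ℂ) (V : Submodule ℂ (n → ℂ))
      (E x : ℝ) (S : Set ℝ) (d : ℝ → ℝ), A.IsHermitian → B.IsHermitian →
      (∀ v : n → ℂ, 0 ≤ (star v ⬝ᵥ B *ᵥ v).re) → (∀ v ∈ V, A *ᵥ v ∈ V) → (∀ v ∈ V, B *ᵥ v ∈ V) →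
      (∀ v ∈ V, star v ⬝ᵥ v = 1 → E ≤ (star v ⬝ᵥ A *ᵥ v).re) → 0 < x →
      (∀ y ∈ S, ∀ v ∈ V, v ≠ 0 → ∀ lam : ℂ,
        (A + (Complex.I * (y : ℂ)) • B) *ᵥ v = lam • v → E + d y ≤ lam.re) →
      ∀ φ ∈ V, star φ ⬝ᵥ φ = 1 →
        ∫⁻ y in S, ENNReal.ofReal (d y * (x / (x ^ 2 + y ^ 2))) ≤
          ENNReal.ofReal (Real.pi * (((star φ ⬝ᵥ A *ᵥ φ).re - E) + x * (star φ ⬝ᵥ B *ᵥ φ).re)) := by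
  intro n _ _ A B V E x S d hA hB hBpos hAV hBV hE hx0 hd φ hφV hφ1
  classical
  -- the Euclidean copy of `V` and an orthonormal basis
  set eN : (n → ℂ) ≃ₗ[ℂ] EuclideanSpace ℂ n := (WithLp.linearEquiv 2 ℂ (n → ℂ)).symm with heN
  set V' : Submodule ℂ (EuclideanSpace ℂ n) := V.map eN.toLinearMap with hV'
  have hmemV' : ∀ v, v ∈ V → WithLp.toLp 2 v ∈ V' := fun v hv =>
    Submodule.mem_map_of_mem (f := eN.toLinearMap) hv
  have hmemV : ∀ x : EuclideanSpace ℂ n, x ∈ V' → WithLp.ofLp x ∈ V := by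
    intro x hx
    obtain ⟨v, hv, rfl⟩ := Submodule.mem_map.mp hx
    exact hv
  set k : ℕ := Module.finrank ℂ V' with hk
  set b : OrthonormalBasis (Fin k) ℂ V' := stdOrthonormalBasis ℂ V' with hb
  -- coordinate map and lift, as linear maps
  set eK : (Fin k → ℂ) ≃ₗ[ℂ] EuclideanSpace ℂ (Fin k) := (WithLp.linearEquiv 2 ℂ (Fin k → ℂ)).symm
    with heK
  set P : EuclideanSpace ℂ n →ₗ[ℂ] V' :=
    (V'.orthogonalProjectionOnto : EuclideanSpace ℂ n →L[ℂ] V').toLinearMap with hP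
  set cL : (n → ℂ) →ₗ[ℂ] (Fin k → ℂ) :=
    eK.symm.toLinearMap ∘ₗ b.repr.toLinearEquiv.toLinearMap ∘ₗ P ∘ₗ eN.toLinearMap with hcL
  set liftL : (Fin k → ℂ) →ₗ[ℂ] (n → ℂ) :=
    eN.symm.toLinearMap ∘ₗ V'.subtype ∘ₗ b.repr.symm.toLinearEquiv.toLinearMap ∘ₗ eK.toLinearMap
    with hliftL
  have hcL_apply : ∀ v : n → ℂ, cL v = WithLp.ofLp (b.repr (P (WithLp.toLp 2 v))) := fun v => rfl
  have hliftL_apply : ∀ x : Fin k → ℂ,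
      liftL x = WithLp.ofLp ((b.repr.symm (WithLp.toLp 2 x) : V') : EuclideanSpace ℂ n) :=
    fun x => rfl
  have hP_mem : ∀ v : n → ℂ, ∀ hv : v ∈ V, P (WithLp.toLp 2 v) = ⟨WithLp.toLp 2 v, hmemV' v hv⟩ :=
    fun v hv => Submodule.orthogonalProjectionOnto_mem_subspace_eq_self (⟨WithLp.toLp 2 v, hmemV' v hv⟩ : V')
  have hPv : ∀ v : V', P (v : EuclideanSpace ℂ n) = v := fun v => by
    rw [hP, ContinuousLinearMap.coe_coe]
    exact Submodule.orthogonalProjectionOnto_mem_subspace_eq_self v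
  -- dictionary
  have hlift_mem : ∀ x, liftL x ∈ V := fun x => hmemV _ (b.repr.symm (WithLp.toLp 2 x)).2
  have hc_lift : ∀ x, cL (liftL x) = x := by
    intro x
    rw [hcL_apply, hliftL_apply, WithLp.toLp_ofLp, hPv]
    simp
  have hlift_c : ∀ v ∈ V, liftL (cL v) = v := by
    intro v hv
    rw [hliftL_apply, hcL_apply, WithLp.toLp_ofLp, LinearIsometryEquiv.symm_apply_apply, hP_mem v hv]
  have hiso : ∀ v ∈ V, ∀ w ∈ V, star (cL v) ⬝ᵥ cL w = star v ⬝ᵥ w := by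
    intro v hv w hw
    rw [hcL_apply, hcL_apply, hP_mem v hv, hP_mem w hw]
    have h1 : ∀ a c : EuclideanSpace ℂ (Fin k), star (WithLp.ofLp a) ⬝ᵥ WithLp.ofLp c = ⟪a, c⟫_ℂ :=
      fun a c => by rw [EuclideanSpace.inner_eq_star_dotProduct, dotProduct_comm]
    rw [h1, LinearIsometryEquiv.inner_map_map, Submodule.coe_inner]
    show ⟪WithLp.toLp 2 v, WithLp.toLp 2 w⟫_ℂ = _
    rw [EuclideanSpace.inner_toLp_toLp, dotProduct_comm]
  have hiso' : ∀ x z : Fin k → ℂ, star x ⬝ᵥ z = star (liftL x) ⬝ᵥ liftL z := by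
    intro x z
    conv_lhs => rw [← hc_lift x, ← hc_lift z]
    exact hiso _ (hlift_mem x) _ (hlift_mem z)
  have hc_inj : ∀ v ∈ V, ∀ w ∈ V, cL v = cL w → v = w := by
    intro v hv w hw h
    rw [← hlift_c v hv, ← hlift_c w hw, h]
  -- the restricted matrices
  set A' : Matrix (Fin k) (Fin k) ℂ := LinearMap.toMatrix' (cL ∘ₗ Matrix.toLin' A ∘ₗ liftL) with hA'
  set B' : Matrix (Fin k) (Fin k) ℂ := LinearMap.toMatrix' (cL ∘ₗ Matrix.toLin' B ∘ₗ liftL) with hB'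
  have hA'mul : ∀ x, A' *ᵥ x = cL (A *ᵥ liftL x) := fun x => by
    rw [hA', LinearMap.toMatrix'_mulVec]; rfl
  have hB'mul : ∀ x, B' *ᵥ x = cL (B *ᵥ liftL x) := fun x => by
    rw [hB', LinearMap.toMatrix'_mulVec]; rfl
  -- quadratic forms transfer
  have hformA : ∀ x z : Fin k → ℂ, star x ⬝ᵥ A' *ᵥ z = star (liftL x) ⬝ᵥ A *ᵥ liftL z := by
    intro x z
    rw [hA'mul]
    conv_lhs => rw [← hc_lift x]
    exact hiso _ (hlift_mem x) _ (hAV _ (hlift_mem z))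
  have hformB : ∀ x z : Fin k → ℂ, star x ⬝ᵥ B' *ᵥ z = star (liftL x) ⬝ᵥ B *ᵥ liftL z := by
    intro x z
    rw [hB'mul]
    conv_lhs => rw [← hc_lift x]
    exact hiso _ (hlift_mem x) _ (hBV _ (hlift_mem z))
  have hA'h : A'.IsHermitian := isHermitian_of_forall_star_dotProduct_mulVec A' fun x z => by
    rw [hformA, hformA, star_dotProduct_mulVec_comm_of_isHermitian hA]
  have hB'h : B'.IsHermitian := isHermitian_of_forall_star_dotProduct_mulVec B' fun x z => by
    rw [hformB, hformB, star_dotProduct_mulVec_comm_of_isHermitian hB]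
  have hB'pos : ∀ x : Fin k → ℂ, 0 ≤ (star x ⬝ᵥ B' *ᵥ x).re := fun x => by
    rw [hformB]; exact hBpos _
  have hE' : ∀ x : Fin k → ℂ, star x ⬝ᵥ x = 1 → E ≤ (star x ⬝ᵥ A' *ᵥ x).re := by
    intro x hx
    rw [hformA]
    refine hE _ (hlift_mem x) ?_
    rw [← hiso' x x, hx]
  -- the transported unit vector
  set φ' : Fin k → ℂ := cL φ with hφ'
  have hφ'1 : star φ' ⬝ᵥ φ' = 1 := by rw [hφ', hiso φ hφV φ hφV, hφ1]
  -- eigenvectors of `A' + iyB'` are coordinates of eigenvectors in `V`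
  have hd' : ∀ y ∈ S, ∀ x : Fin k → ℂ, x ≠ 0 → ∀ lam : ℂ,
      (A' + (Complex.I * (y : ℂ)) • B') *ᵥ x = lam • x → E + d y ≤ lam.re := by
    intro y hy x hx lam heq
    set v := liftL x with hv
    have hvV : v ∈ V := hlift_mem x
    have hv0 : v ≠ 0 := by
      intro h0
      apply hx
      rw [← hc_lift x, ← hv, h0, map_zero]
    have hmem : (A + (Complex.I * (y : ℂ)) • B) *ᵥ v ∈ V := by
      rw [add_mulVec, smul_mulVec]
      exact V.add_mem (hAV v hvV) (V.smul_mem _ (hBV v hvV))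
    have hcoord : cL ((A + (Complex.I * (y : ℂ)) • B) *ᵥ v) = cL (lam • v) := by
      rw [add_mulVec, smul_mulVec, map_add, map_smul, map_smul, ← hA'mul, ← hB'mul, hc_lift x,
        ← heq, add_mulVec, smul_mulVec]
    have heqV := hc_inj _ hmem _ (V.smul_mem lam hvV) hcoord
    exact hd y hy v hvV hv0 lam heqV
  -- nonempty index type
  have hk0 : 0 < k := by
    rw [hk, Module.finrank_pos_iff_exists_ne_zero]
    refine ⟨⟨WithLp.toLp 2 φ, hmemV' φ hφV⟩, fun h0 => ?_⟩
    have h1 : WithLp.toLp 2 φ = (0 : EuclideanSpace ℂ n) := congrArg Subtype.val h0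
    have h2 : φ = 0 := by
      have := congrArg WithLp.ofLp h1
      simpa using this
    rw [h2, dotProduct_zero] at hφ1
    exact zero_ne_one hφ1
  haveI : Nonempty (Fin k) := ⟨⟨0, hk0⟩⟩
  -- apply the core
  have hcore := finiteXFloor_core A' B' hA'h hB'h hB'pos E x hx0 S d φ' hE' hφ'1 hd'
  have hα : (star φ' ⬝ᵥ A' *ᵥ φ').re = (star φ ⬝ᵥ A *ᵥ φ).re := by
    rw [hformA, hφ', hlift_c φ hφV]
  have hβ : (star φ' ⬝ᵥ B' *ᵥ φ').re = (star φ ⬝ᵥ B *ᵥ φ).re := by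
    rw [hformB, hφ', hlift_c φ hφV]
  rw [hα, hβ] at hcore
  exact hcore

end Summit.HubbardSuperconductivity.HubbardSuperconductivity.Theorems.KkBandLift.Negative
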